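import Summits.KontsevichZagierPeriods.KontsevichZagierPeriods.Theorems.HermiteRigidityIslandComplementFiveTermDilogPrimitives
import Summits.KontsevichZagierPeriods.KontsevichZagierPeriods.Theorems.HermiteRigidityIslandComplementFiveTermLogPrimitives
import Summits.KontsevichZagierPeriods.KontsevichZagierPeriods.Theorems.HermiteRigidityIslandComplementCubeSubdivision
import Literature.NumberTheory.Transcendental.KZRulesAssociator

/-!
# `ReductionRigidity` (stmt-KontsevichZagierPeriods-3407), line `Sketch`, stub `stub_islandComplement`:
# the five-term certificate, III — the five-term relation as a chain of moves (`stub_boxFiveTerm`)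

Route `KontsevichZagierPeriods/HermiteRigidity`, crux `ReductionRigidity` (stmt-3407); growth deliverable
G5 of `Cruxes/ReductionRigidity/STUB-PLAN-stub_islandComplement.md`, part 3. For all rationals
`0 < x, y < 1`, **Abel's five-term relation of the dilogarithm holds in the Kontsevich–Zagier calculus**:

  `[□², x/(1−xpq)] + [□², y/(1−ypq)] − [□², xy/(1−xypq)] − [□², A/(1−Apq)] − [□², B/(1−Bpq)]`
  `− [□², ℓ₁(p)ℓ₂(q)] ∈ KZ.relations`,

`A = x(1−y)/(1−xy)`, `B = y(1−x)/(1−xy)` (values `Li₂(x) + Li₂(y) − Li₂(xy) − Li₂(A) − Li₂(B)` and the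
product `log((1−x)/(1−xy))·log((1−y)/(1−xy))` of the two dlogs `ℓ₁ = x(1−y)/(1−xy−x(1−y)p)`,
`ℓ₂ = y(1−x)/(1−xy−y(1−x)q)`). The chain of moves: deform `x ↦ sx` (`s ∈ [0,1]`); six Stokes moves in
`s` turn the six squares into `[□³, ∂ₛK]` for the kernels of parts I–II (the faces `s = 0` cancel:
`K_y|₀ = K_B|₀`, the others vanish); exactness `∂ₛKᵢ = ∂ₚGᵢ` (dilogarithm terms) and
`∂ₛW = ∂ₚG_W + ∂_qH_W` (logarithmic term) and six Stokes moves in `p`/`q` leave seven face functions on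
`□²`, whose signed sum is, POINTWISE, the three-slab dlog `F − S₁ − S₂` (`F = x/(1−txu)`,
`S₁ = xy/(1−txyu)`, `S₂ = x(1−y)/(1−tx(y+(1−y)u))`, i.e. `∫₀¹ = ∫₀^y + ∫_y^1` of one dlog slab); and
`[F] ≡ [S₁] + [S₂]` is the subdivision of the square at height `u = y` (`stub_subdivAt`). Bookkeeping
on `χ`-values for an arbitrary additive `χ` killing relations (`fiveTerm_chi`), then specialised to the
quotient map onto the formal period ring.

References: M. Kontsevich, D. Zagier, *Periods* (2001), §1.2 rules (1)–(3)
[cite: KontsevichZagier2001, §1.2]; D. Zagier, *The dilogarithm function* (2007), Ch. I §2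
[cite: Zagier2007Dilogarithm, Ch. I §2]. No definitions are introduced.
-/

noncomputable section

open MeasureTheory Set MvPolynomial

namespace Summit.KontsevichZagierPeriods.HermiteRigidity.ReductionRigidity

open Literature.NumberTheory.Transcendental
open Literature.NumberTheory.Transcendental.KZ

/-! ## Faces of `□³`, bounds and the two pointwise identities -/

/-- Inserting a coordinate `c ∈ [0,1]` into a point of `□²` gives a point of `□³`. [folklore] -/
theorem insertNth_mem_cube_three (i : Fin 3) {c : ℝ} (hc : 0 ≤ c ∧ c ≤ 1) {x : Fin 2 → ℝ}
    (hx : x ∈ cube 2) : (Fin.insertNth i c x : Fin 3 → ℝ) ∈ cube 3 := by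
  intro j
  induction j using Fin.succAboveCases i with
  | x => rw [Fin.insertNth_apply_same]; exact hc
  | p k => rw [Fin.insertNth_apply_succAbove]; exact hx k

/-- The denominators of the seven face functions are positive on `□²` (`0 < x, y < 1`). [folklore] -/
theorem fiveTerm_face_den_pos {x y : ℚ} (hx : 0 < x) (hx1 : x < 1) (hy : 0 < y) (hy1 : y < 1)
    {u : Fin 2 → ℝ} (hu : u ∈ cube 2) :
    0 < 1 - (x:ℝ) * y * u 1 ∧ 0 < 1 - (x:ℝ) * y * u 1 - (x:ℝ) * (1 - y) * u 1 * u 0 ∧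
      0 < 1 - (x:ℝ) * u 1 * ((y:ℝ) + (1 - y) * u 0) ∧ 0 < 1 - (y:ℝ) * ((x:ℝ) * u 1) ∧
      0 < 1 - u 1 * (x:ℝ) * ((y:ℝ) + (1 - y) * u 0) ∧
      0 < 1 - (x:ℝ) * y * u 1 - (y:ℝ) * (1 - x * u 1) * u 0 ∧ 0 < 1 - (x:ℝ) * u 1 ∧
      0 < 1 - (y:ℝ) * ((x:ℝ) * u 1 + (1 - (x:ℝ) * u 1) * u 0) ∧ 0 < 1 - (x:ℝ) * u 1 * y := by
  have hx' : (0:ℝ) < x := by exact_mod_cast hx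
  have hx1' : (x:ℝ) < 1 := by exact_mod_cast hx1
  have hy' : (0:ℝ) < y := by exact_mod_cast hy
  have hy1' : (y:ℝ) < 1 := by exact_mod_cast hy1
  have h0 := hu 0; have h1 := hu 1
  have hxy : (x:ℝ) * y < x := by nlinarith
  have e1 : (x:ℝ) * y * u 1 ≤ x * y := by nlinarith [mul_pos hx' hy']
  have hm0 : 0 ≤ (y:ℝ) + (1 - y) * u 0 := by nlinarith
  have hm1 : (y:ℝ) + (1 - y) * u 0 ≤ 1 := by nlinarith
  have hxu0 : 0 ≤ (x:ℝ) * u 1 := by nlinarith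
  have hxu1 : (x:ℝ) * u 1 ≤ x := by nlinarith
  have e3 : (x:ℝ) * u 1 * ((y:ℝ) + (1 - y) * u 0) ≤ x * 1 := mul_le_mul hxu1 hm1 hm0 hx'.le
  have e2 : (x:ℝ) * (1 - y) * u 1 * u 0 ≤ x * (1 - y) := by
    have := mul_nonneg (mul_pos hx' (sub_pos.2 hy1')).le h1.1
    nlinarith [mul_le_one₀ h1.2 h0.1 h0.2]
  have e6 : (y:ℝ) * (1 - x * u 1) * u 0 ≤ y * (1 - x * u 1) := by
    have := mul_nonneg hy'.le (by nlinarith : (0:ℝ) ≤ 1 - x * u 1)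
    nlinarith
  have hn0 : 0 ≤ (x:ℝ) * u 1 + (1 - (x:ℝ) * u 1) * u 0 := by nlinarith
  have hn1 : (x:ℝ) * u 1 + (1 - (x:ℝ) * u 1) * u 0 ≤ 1 := by nlinarith
  have e8 : (y:ℝ) * ((x:ℝ) * u 1 + (1 - (x:ℝ) * u 1) * u 0) ≤ y * 1 :=
    mul_le_mul_of_nonneg_left hn1 hy'.le
  refine ⟨by nlinarith, by nlinarith, by nlinarith, by nlinarith, by nlinarith, by nlinarith,
    by nlinarith, by nlinarith, by nlinarith⟩

/-- First pointwise identity of the residual: `−G_A|_{p=1} + H_W|_{q=0} = −S₂`. [folklore] -/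
theorem fiveTerm_residual_one {x y : ℚ} (hx : 0 < x) (hx1 : x < 1) (hy : 0 < y) (hy1 : y < 1)
    {u : Fin 2 → ℝ} (hu : u ∈ cube 2) :
    -((x:ℝ) * (1 - y) / ((1 - (x:ℝ) * y * u 1) * (1 - (x:ℝ) * y * u 1 - (x:ℝ) * (1 - y) * u 1 * u 0))) +
        u 1 * (x:ℝ) ^ 2 * y * (1 - y) /
          ((1 - (x:ℝ) * u 1 * ((y:ℝ) + (1 - y) * u 0)) * (1 - (y:ℝ) * ((x:ℝ) * u 1))) =
      -((x:ℝ) * (1 - y) / (1 - u 1 * (x:ℝ) * ((y:ℝ) + (1 - y) * u 0))) := by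
  obtain ⟨h1, h2, h3, h4, h5, -⟩ := fiveTerm_face_den_pos hx hx1 hy hy1 hu
  have := h1.ne'; have := h2.ne'; have := h3.ne'; have := h4.ne'; have := h5.ne'
  field_simp
  ring

/-- Second pointwise identity of the residual: `−G_B|_{p=1} − G_W|_{p=1} + G_W|_{p=0} = 0`. [folklore] -/
theorem fiveTerm_residual_two {x y : ℚ} (hx : 0 < x) (hx1 : x < 1) (hy : 0 < y) (hy1 : y < 1)
    {u : Fin 2 → ℝ} (hu : u ∈ cube 2) :
    -(-((x:ℝ) * y * (1 - y)) /
          ((1 - (x:ℝ) * y * u 1) * (1 - (x:ℝ) * y * u 1 - (y:ℝ) * (1 - x * u 1) * u 0))) -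
        (x:ℝ) * y * (1 - x * u 1) / ((1 - (x:ℝ) * u 1) * (1 - (y:ℝ) * ((x:ℝ) * u 1 + (1 - (x:ℝ) * u 1) * u 0))) +
        (x:ℝ) * y * y * (1 - x * u 1) /
          ((1 - (x:ℝ) * u 1 * y) * (1 - (y:ℝ) * ((x:ℝ) * u 1 + (1 - (x:ℝ) * u 1) * u 0))) = 0 := by
  obtain ⟨h1, -, -, -, -, h6, h7, h8, h9⟩ := fiveTerm_face_den_pos hx hx1 hy hy1 hu
  have := h1.ne'; have := h6.ne'; have := h7.ne'; have := h8.ne'; have := h9.ne'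
  field_simp
  ring

/-! ## The chain of moves, on `χ`-values -/

section Chi

variable {R : Type} [CommRing R] {χ : KZ.FormalRep →+ R}
variable (hrel : ∀ c ∈ KZ.relations, χ c = 0)
include hrel

/-- **The five-term relation as a chain of moves, `χ`-form**: for every additive `χ` killing
`KZ.relations` and rationals `0 < x, y < 1`,
`χ[x/(1−xpq)] + χ[y/(1−ypq)] − χ[xy/(1−xypq)] − χ[A/(1−Apq)] − χ[B/(1−Bpq)] − χ[ℓ₁ℓ₂] = 0`.
Twelve Stokes moves, the exactness identities of parts I–II, the two pointwise residual identities and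
one subdivision at height `y`. [cite: KontsevichZagier2001, §1.2 rules (1)–(3)] -/
theorem fiveTerm_chi {x y : ℚ} (hx : 0 < x) (hx1 : x < 1) (hy : 0 < y) (hy1 : y < 1)
    (r₁ r₂ r₃ r₄ r₅ r₆ : IntegralRep 2)
    (hr₁ : r₁.domain = cube 2)
    (hr₁i : EqOn r₁.integrand (fun p => (x : ℝ) / (1 - (x : ℝ) * p 0 * p 1)) (cube 2))
    (hr₂ : r₂.domain = cube 2)
    (hr₂i : EqOn r₂.integrand (fun p => (y : ℝ) / (1 - (y : ℝ) * p 0 * p 1)) (cube 2))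
    (hr₃ : r₃.domain = cube 2)
    (hr₃i : EqOn r₃.integrand (fun p => (x : ℝ) * y / (1 - (x : ℝ) * y * p 0 * p 1)) (cube 2))
    (hr₄ : r₄.domain = cube 2)
    (hr₄i : EqOn r₄.integrand
      (fun p => (x : ℝ) * (1 - y) / (1 - (x : ℝ) * y - (x : ℝ) * (1 - y) * p 0 * p 1)) (cube 2))
    (hr₅ : r₅.domain = cube 2)
    (hr₅i : EqOn r₅.integrand
      (fun p => (y : ℝ) * (1 - x) / (1 - (x : ℝ) * y - (y : ℝ) * (1 - x) * p 0 * p 1)) (cube 2))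
    (hr₆ : r₆.domain = cube 2)
    (hr₆i : EqOn r₆.integrand (fun p => ((x : ℝ) * (1 - y) / (1 - (x : ℝ) * y - (x : ℝ) * (1 - y) * p 0)) *
      ((y : ℝ) * (1 - x) / (1 - (x : ℝ) * y - (y : ℝ) * (1 - x) * p 1))) (cube 2)) :
    χ (KZ.of r₁) + χ (KZ.of r₂) - χ (KZ.of r₃) - χ (KZ.of r₄) - χ (KZ.of r₅) - χ (KZ.of r₆) = 0 := by
  have hx' : (0:ℝ) < x := by exact_mod_cast hx
  have hx1' : (x:ℝ) < 1 := by exact_mod_cast hx1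
  have hy' : (0:ℝ) < y := by exact_mod_cast hy
  have hy1' : (y:ℝ) < 1 := by exact_mod_cast hy1
  obtain ⟨K₁, G₁, Ky, K₂, G₂, KA, GA, KB, GB, hK₁, hK₁', hG₁, hG₁', hKy, hKy', hK₂, hK₂', hG₂, hG₂',
    hKA, hKA', hGA, hGA', hKB, hKB', hGB, hGB'⟩ := stub_fiveTermDilogPrimitives x y hx hx1 hy hy1
  obtain ⟨W, GW, HW, F, S₁, S₂, hW, hW', hGW, hGW', hHW, hHW', hF, hS₁, hS₂⟩ :=
    stub_fiveTermLogPrimitives x y hx hx1 hy hy1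
  have h1 : (0:ℚ) ≤ 1 ∧ (1:ℚ) ≤ 1 := ⟨zero_le_one, le_rfl⟩
  have h0 : (0:ℚ) ≤ 0 ∧ (0:ℚ) ≤ 1 := ⟨le_rfl, zero_le_one⟩
  have m1 : ∀ (i : Fin 3) {u : Fin 2 → ℝ}, u ∈ cube 2 →
      (Fin.insertNth i (((1:ℚ):ℝ)) u : Fin 3 → ℝ) ∈ cube 3 :=
    fun i u hu => insertNth_mem_cube_three i (by norm_num) hu
  have m0 : ∀ (i : Fin 3) {u : Fin 2 → ℝ}, u ∈ cube 2 →
      (Fin.insertNth i (((0:ℚ):ℝ)) u : Fin 3 → ℝ) ∈ cube 3 :=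
    fun i u hu => insertNth_mem_cube_three i (by norm_num) hu
  -- the faces `s = 1`: the six squares
  have tK₁ : ∀ u ∈ cube 2, (K₁.faceAt 2 1 h1).fn u = (x:ℝ) / (1 - (x:ℝ) * u 0 * u 1) := by
    intro u hu
    rw [RFun.fn_faceAt, hK₁ _ (m1 2 hu), insertNth_two_apply_zero, insertNth_two_apply_one,
      insertNth_two_apply_two]; push_cast; ring
  have tKy : ∀ u ∈ cube 2, (Ky.faceAt 2 1 h1).fn u = (y:ℝ) / (1 - (y:ℝ) * u 0 * u 1) := by
    intro u hu
    rw [RFun.fn_faceAt, hKy _ (m1 2 hu), insertNth_two_apply_zero, insertNth_two_apply_one]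
  have tK₂ : ∀ u ∈ cube 2, (K₂.faceAt 2 1 h1).fn u = (x:ℝ) * y / (1 - (x:ℝ) * y * u 0 * u 1) := by
    intro u hu
    rw [RFun.fn_faceAt, hK₂ _ (m1 2 hu), insertNth_two_apply_zero, insertNth_two_apply_one,
      insertNth_two_apply_two]; push_cast; ring
  have tKA : ∀ u ∈ cube 2, (KA.faceAt 2 1 h1).fn u =
      (x:ℝ) * (1 - y) / (1 - (x:ℝ) * y - (x:ℝ) * (1 - y) * u 0 * u 1) := by
    intro u hu
    rw [RFun.fn_faceAt, hKA _ (m1 2 hu), insertNth_two_apply_zero, insertNth_two_apply_one,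
      insertNth_two_apply_two]; push_cast; ring
  have tKB : ∀ u ∈ cube 2, (KB.faceAt 2 1 h1).fn u =
      (y:ℝ) * (1 - x) / (1 - (x:ℝ) * y - (y:ℝ) * (1 - x) * u 0 * u 1) := by
    intro u hu
    rw [RFun.fn_faceAt, hKB _ (m1 2 hu), insertNth_two_apply_zero, insertNth_two_apply_one,
      insertNth_two_apply_two]; push_cast; ring
  have tW : ∀ u ∈ cube 2, (W.faceAt 2 1 h1).fn u =
      (x:ℝ) * (1 - y) * ((y:ℝ) * (1 - x)) /
        ((1 - (x:ℝ) * ((y:ℝ) + (1 - y) * u 0)) * (1 - (y:ℝ) * ((x:ℝ) + (1 - (x:ℝ)) * u 1))) := by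
    intro u hu
    rw [RFun.fn_faceAt, hW _ (m1 2 hu), insertNth_two_apply_zero, insertNth_two_apply_one,
      insertNth_two_apply_two]; push_cast; ring
  -- the faces `s = 0`: four vanish, and `K_y|₀ = K_B|₀`
  have bK₁ : (K₁.faceAt 2 0 h0).chi χ = 0 := RFun.chi_eq_zero hrel fun u hu => by
    rw [RFun.fn_faceAt, hK₁ _ (m0 2 hu), insertNth_two_apply_two]; push_cast; ring
  have bK₂ : (K₂.faceAt 2 0 h0).chi χ = 0 := RFun.chi_eq_zero hrel fun u hu => by
    rw [RFun.fn_faceAt, hK₂ _ (m0 2 hu), insertNth_two_apply_two]; push_cast; ring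
  have bKA : (KA.faceAt 2 0 h0).chi χ = 0 := RFun.chi_eq_zero hrel fun u hu => by
    rw [RFun.fn_faceAt, hKA _ (m0 2 hu), insertNth_two_apply_two]; push_cast; ring
  have bW : (W.faceAt 2 0 h0).chi χ = 0 := RFun.chi_eq_zero hrel fun u hu => by
    rw [RFun.fn_faceAt, hW _ (m0 2 hu), insertNth_two_apply_two]; push_cast; ring
  have bKyKB : (Ky.faceAt 2 0 h0).chi χ = (KB.faceAt 2 0 h0).chi χ :=
    RFun.chi_congr hrel fun u hu => by
      rw [RFun.fn_faceAt, RFun.fn_faceAt, hKy _ (m0 2 hu), hKB _ (m0 2 hu),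
        insertNth_two_apply_zero, insertNth_two_apply_one, insertNth_two_apply_two]
      push_cast; ring
  -- `K_y` does not depend on `s`
  have zKy : (Ky.pd 2).chi χ = 0 := RFun.chi_eq_zero hrel fun p hp => hKy' p hp
  -- the faces `p = 0` of the primitives: four vanish, `G_W|₀` does not
  have bG₁ : (G₁.faceAt 0 0 h0).chi χ = 0 := RFun.chi_eq_zero hrel fun u hu => by
    rw [RFun.fn_faceAt, hG₁ _ (m0 0 hu), insertNth_zero_apply_zero]; push_cast; ring
  have bG₂ : (G₂.faceAt 0 0 h0).chi χ = 0 := RFun.chi_eq_zero hrel fun u hu => by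
    rw [RFun.fn_faceAt, hG₂ _ (m0 0 hu), insertNth_zero_apply_zero]; push_cast; ring
  have bGA : (GA.faceAt 0 0 h0).chi χ = 0 := RFun.chi_eq_zero hrel fun u hu => by
    rw [RFun.fn_faceAt, hGA _ (m0 0 hu), insertNth_zero_apply_zero]; push_cast; ring
  have bGB : (GB.faceAt 0 0 h0).chi χ = 0 := RFun.chi_eq_zero hrel fun u hu => by
    rw [RFun.fn_faceAt, hGB _ (m0 0 hu), insertNth_zero_apply_zero]; push_cast; ring
  have gbW : ∀ u ∈ cube 2, (GW.faceAt 0 0 h0).fn u = (x:ℝ) * y * y * (1 - x * u 1) /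
      ((1 - (x:ℝ) * u 1 * y) * (1 - (y:ℝ) * ((x:ℝ) * u 1 + (1 - (x:ℝ) * u 1) * u 0))) := by
    intro u hu
    rw [RFun.fn_faceAt, hGW _ (m0 0 hu), insertNth_zero_apply_zero, insertNth_zero_apply_one,
      insertNth_zero_apply_two]; push_cast; ring
  -- the faces `p = 1` of the primitives
  have gt₁ : ∀ u ∈ cube 2, (G₁.faceAt 0 1 h1).fn u = (x:ℝ) / (1 - u 1 * (x:ℝ) * u 0) := by
    intro u hu
    rw [RFun.fn_faceAt, hG₁ _ (m1 0 hu), insertNth_zero_apply_zero, insertNth_zero_apply_one,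
      insertNth_zero_apply_two]; push_cast; ring
  have gt₂ : ∀ u ∈ cube 2, (G₂.faceAt 0 1 h1).fn u = (x:ℝ) * y / (1 - u 1 * (x:ℝ) * y * u 0) := by
    intro u hu
    rw [RFun.fn_faceAt, hG₂ _ (m1 0 hu), insertNth_zero_apply_zero, insertNth_zero_apply_one,
      insertNth_zero_apply_two]; push_cast; ring
  have gtA : ∀ u ∈ cube 2, (GA.faceAt 0 1 h1).fn u = (x:ℝ) * (1 - y) /
      ((1 - (x:ℝ) * y * u 1) * (1 - (x:ℝ) * y * u 1 - (x:ℝ) * (1 - y) * u 1 * u 0)) := by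
    intro u hu
    rw [RFun.fn_faceAt, hGA _ (m1 0 hu), insertNth_zero_apply_zero, insertNth_zero_apply_one,
      insertNth_zero_apply_two]; push_cast; ring
  have gtB : ∀ u ∈ cube 2, (GB.faceAt 0 1 h1).fn u = -((x:ℝ) * y * (1 - y)) /
      ((1 - (x:ℝ) * y * u 1) * (1 - (x:ℝ) * y * u 1 - (y:ℝ) * (1 - x * u 1) * u 0)) := by
    intro u hu
    rw [RFun.fn_faceAt, hGB _ (m1 0 hu), insertNth_zero_apply_zero, insertNth_zero_apply_one,
      insertNth_zero_apply_two]; push_cast; ring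
  have gtW : ∀ u ∈ cube 2, (GW.faceAt 0 1 h1).fn u = (x:ℝ) * y * (1 - x * u 1) /
      ((1 - (x:ℝ) * u 1) * (1 - (y:ℝ) * ((x:ℝ) * u 1 + (1 - (x:ℝ) * u 1) * u 0))) := by
    intro u hu
    rw [RFun.fn_faceAt, hGW _ (m1 0 hu), insertNth_zero_apply_zero, insertNth_zero_apply_one,
      insertNth_zero_apply_two]; push_cast; ring
  -- the faces `q = 1`, `q = 0` of `H_W`
  have ht : (HW.faceAt 1 1 h1).chi χ = 0 := RFun.chi_eq_zero hrel fun u hu => by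
    rw [RFun.fn_faceAt, hHW _ (m1 1 hu), insertNth_one_apply_one]; push_cast; ring
  have hb : ∀ u ∈ cube 2, (HW.faceAt 1 0 h0).fn u = u 1 * (x:ℝ) ^ 2 * y * (1 - y) /
      ((1 - (x:ℝ) * u 1 * ((y:ℝ) + (1 - y) * u 0)) * (1 - (y:ℝ) * ((x:ℝ) * u 1))) := by
    intro u hu
    rw [RFun.fn_faceAt, hHW _ (m0 1 hu), insertNth_one_apply_zero, insertNth_one_apply_one,
      insertNth_one_apply_two]; push_cast; ring
  -- the twelve Stokes moves
  have sK₁ := RFun.chi_stokesAt hrel 2 K₁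
  have sKy := RFun.chi_stokesAt hrel 2 Ky
  have sK₂ := RFun.chi_stokesAt hrel 2 K₂
  have sKA := RFun.chi_stokesAt hrel 2 KA
  have sKB := RFun.chi_stokesAt hrel 2 KB
  have sW := RFun.chi_stokesAt hrel 2 W
  have sG₁ := RFun.chi_stokesAt hrel 0 G₁
  have sG₂ := RFun.chi_stokesAt hrel 0 G₂
  have sGA := RFun.chi_stokesAt hrel 0 GA
  have sGB := RFun.chi_stokesAt hrel 0 GB
  have sGW := RFun.chi_stokesAt hrel 0 GW
  have sHW := RFun.chi_stokesAt hrel 1 HW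
  -- exactness
  have e₁ : (K₁.pd 2).chi χ = (G₁.pd 0).chi χ :=
    RFun.chi_congr hrel fun p hp => by rw [hK₁' p hp, hG₁' p hp]
  have e₂ : (K₂.pd 2).chi χ = (G₂.pd 0).chi χ :=
    RFun.chi_congr hrel fun p hp => by rw [hK₂' p hp, hG₂' p hp]
  have eA : (KA.pd 2).chi χ = (GA.pd 0).chi χ :=
    RFun.chi_congr hrel fun p hp => by rw [hKA' p hp, hGA' p hp]
  have eB : (KB.pd 2).chi χ = (GB.pd 0).chi χ :=
    RFun.chi_congr hrel fun p hp => by rw [hKB' p hp, hGB' p hp]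
  have eW : (W.pd 2).chi χ = (GW.pd 0).chi χ + (HW.pd 1).chi χ := by
    rw [← RFun.chi_add hrel]
    exact RFun.chi_congr hrel fun p hp => by rw [RFun.fn_add hp, hW' p hp, hGW' p hp, hHW' p hp]
  -- the residual: seven face functions sum to the three-slab dlog `F − S₁ − S₂`
  have eU : ((((((G₁.faceAt 0 1 h1).sub (G₂.faceAt 0 1 h1)).sub (GA.faceAt 0 1 h1)).sub
      (GB.faceAt 0 1 h1)).sub (GW.faceAt 0 1 h1)).add (GW.faceAt 0 0 h0) |>.add
        (HW.faceAt 1 0 h0)).chi χ = ((F.sub S₁).sub S₂).chi χ := by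
    refine RFun.chi_congr hrel fun u hu => ?_
    rw [RFun.fn_add hu, RFun.fn_add hu, RFun.fn_sub hu, RFun.fn_sub hu, RFun.fn_sub hu,
      RFun.fn_sub hu, RFun.fn_sub hu, RFun.fn_sub hu, gt₁ u hu, gt₂ u hu, gtA u hu, gtB u hu,
      gtW u hu, gbW u hu, hb u hu, hF u hu, hS₁ u hu, hS₂ u hu]
    linear_combination fiveTerm_residual_one hx hx1 hy hy1 hu + fiveTerm_residual_two hx hx1 hy hy1 hu
  have eU' : ((((((G₁.faceAt 0 1 h1).sub (G₂.faceAt 0 1 h1)).sub (GA.faceAt 0 1 h1)).sub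
      (GB.faceAt 0 1 h1)).sub (GW.faceAt 0 1 h1)).add (GW.faceAt 0 0 h0) |>.add
        (HW.faceAt 1 0 h0)).chi χ =
      (G₁.faceAt 0 1 h1).chi χ - (G₂.faceAt 0 1 h1).chi χ - (GA.faceAt 0 1 h1).chi χ -
        (GB.faceAt 0 1 h1).chi χ - (GW.faceAt 0 1 h1).chi χ + (GW.faceAt 0 0 h0).chi χ +
        (HW.faceAt 1 0 h0).chi χ := by
    rw [RFun.chi_add hrel, RFun.chi_add hrel, RFun.chi_sub hrel, RFun.chi_sub hrel,
      RFun.chi_sub hrel, RFun.chi_sub hrel]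
  have eFS : ((F.sub S₁).sub S₂).chi χ = F.chi χ - S₁.chi χ - S₂.chi χ := by
    rw [RFun.chi_sub hrel, RFun.chi_sub hrel]
  -- the subdivision of the square at height `u = y`
  have eSub : F.chi χ = S₁.chi χ + S₂.chi χ := by
    refine rfun_chi_subdivAt hrel 0 hy hy1 F S₁ S₂ (fun u hu => ?_) (fun u hu => ?_)
    · have hu' : Function.update u 0 ((y:ℝ) * u 0) ∈ cube 2 :=
        KZ.update_mem_cube hu 0 (by nlinarith [(hu 0).1]) (by nlinarith [(hu 0).2])
      rw [hS₁ u hu, hF _ hu', Function.update_self,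
        Function.update_of_ne (show (1 : Fin 2) ≠ 0 by decide)]
      ring
    · have hu' : Function.update u 0 ((y:ℝ) + (1 - (y:ℝ)) * u 0) ∈ cube 2 :=
        KZ.update_mem_cube hu 0 (by nlinarith [(hu 0).1]) (by nlinarith [(hu 0).2])
      rw [hS₂ u hu, hF _ hu', Function.update_self,
        Function.update_of_ne (show (1 : Fin 2) ≠ 0 by decide)]
      ring
  -- the six squares as faces
  have c₁ : χ (KZ.of r₁) = (K₁.faceAt 2 1 h1).chi χ :=
    rfun_chi_of_eq hrel _ hr₁ fun u hu => by rw [hr₁i hu, tK₁ u hu]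
  have c₂ : χ (KZ.of r₂) = (Ky.faceAt 2 1 h1).chi χ :=
    rfun_chi_of_eq hrel _ hr₂ fun u hu => by rw [hr₂i hu, tKy u hu]
  have c₃ : χ (KZ.of r₃) = (K₂.faceAt 2 1 h1).chi χ :=
    rfun_chi_of_eq hrel _ hr₃ fun u hu => by rw [hr₃i hu, tK₂ u hu]
  have c₄ : χ (KZ.of r₄) = (KA.faceAt 2 1 h1).chi χ :=
    rfun_chi_of_eq hrel _ hr₄ fun u hu => by rw [hr₄i hu, tKA u hu]
  have c₅ : χ (KZ.of r₅) = (KB.faceAt 2 1 h1).chi χ :=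
    rfun_chi_of_eq hrel _ hr₅ fun u hu => by rw [hr₅i hu, tKB u hu]
  have c₆ : χ (KZ.of r₆) = (W.faceAt 2 1 h1).chi χ :=
    rfun_chi_of_eq hrel _ hr₆ fun u hu => by
      rw [hr₆i hu, tW u hu]; beta_reduce; rw [div_mul_div_comm]; ring
  linear_combination c₁ + c₂ - c₃ - c₄ - c₅ - c₆ - sK₁ - sKy + sK₂ + sKA + sKB + sW + bK₁ + bKyKB -
    bK₂ - bKA - bW + zKy + e₁ - e₂ - eA - eB - eW + sG₁ - sG₂ - sGA - sGB - sGW - sHW - bG₁ + bG₂ +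
    bGA + bGB - ht - eU' + eU + eFS + eSub

end Chi

/-! ## The registered sub-goal stub -/

/-- **Stub `stub_boxFiveTerm`** (sub-goal of crux `ReductionRigidity`, stmt-3407, line `Sketch`, growth
deliverable G5 for the remainder stub `stub_islandComplement`): **Abel's five-term relation of the
dilogarithm as a chain of moves of the Kontsevich–Zagier calculus**, for all rationals `0 < x, y < 1`
and any representations on the closed square with the printed integrands:
`[x/(1−xpq)] + [y/(1−ypq)] − [xy/(1−xypq)] − [x(1−y)/(1−xy−x(1−y)pq)] − [y(1−x)/(1−xy−y(1−x)pq)]`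
`− [(x(1−y)/(1−xy−x(1−y)p))·(y(1−x)/(1−xy−y(1−x)q))] ∈ KZ.relations`
(`Li₂(x) + Li₂(y) − Li₂(xy) − Li₂(x(1−y)/(1−xy)) − Li₂(y(1−x)/(1−xy)) = log((1−x)/(1−xy))log((1−y)/(1−xy))`).
[cite: Zagier2007Dilogarithm, Ch. I §2] -/
theorem stub_boxFiveTerm :
    ∀ (x y : ℚ), 0 < x → x < 1 → 0 < y → y < 1 → ∀ (r₁ r₂ r₃ r₄ r₅ r₆ : IntegralRep 2),
      r₁.domain = cube 2 →
      EqOn r₁.integrand (fun p => (x : ℝ) / (1 - (x : ℝ) * p 0 * p 1)) (cube 2) →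
      r₂.domain = cube 2 →
      EqOn r₂.integrand (fun p => (y : ℝ) / (1 - (y : ℝ) * p 0 * p 1)) (cube 2) →
      r₃.domain = cube 2 →
      EqOn r₃.integrand (fun p => (x : ℝ) * y / (1 - (x : ℝ) * y * p 0 * p 1)) (cube 2) →
      r₄.domain = cube 2 →
      EqOn r₄.integrand
        (fun p => (x : ℝ) * (1 - y) / (1 - (x : ℝ) * y - (x : ℝ) * (1 - y) * p 0 * p 1)) (cube 2) →
      r₅.domain = cube 2 →
      EqOn r₅.integrand
        (fun p => (y : ℝ) * (1 - x) / (1 - (x : ℝ) * y - (y : ℝ) * (1 - x) * p 0 * p 1)) (cube 2) →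
      r₆.domain = cube 2 →
      EqOn r₆.integrand (fun p => ((x : ℝ) * (1 - y) / (1 - (x : ℝ) * y - (x : ℝ) * (1 - y) * p 0)) *
        ((y : ℝ) * (1 - x) / (1 - (x : ℝ) * y - (y : ℝ) * (1 - x) * p 1))) (cube 2) →
      KZ.of r₁ + KZ.of r₂ - KZ.of r₃ - KZ.of r₄ - KZ.of r₅ - KZ.of r₆ ∈ KZ.relations := by
  intro x y hx hx1 hy hy1 r₁ r₂ r₃ r₄ r₅ r₆ hr₁ hr₁i hr₂ hr₂i hr₃ hr₃i hr₄ hr₄i hr₅ hr₅i hr₆ hr₆i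
  have h := fiveTerm_chi (χ := (toFormalPeriod.toAddMonoidHom : FormalRep →+ FormalPeriodRing))
    (fun c hc => toFormalPeriod_eq_zero_of_mem hc) hx hx1 hy hy1 r₁ r₂ r₃ r₄ r₅ r₆ hr₁ hr₁i hr₂ hr₂i
    hr₃ hr₃i hr₄ hr₄i hr₅ hr₅i hr₆ hr₆i
  rw [← toFormalPeriod_eq_zero_iff, map_sub, map_sub, map_sub, map_sub, map_add]
  simpa using h

end Summit.KontsevichZagierPeriods.HermiteRigidity.ReductionRigidity

end
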